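import Literature.AlgebraicGeometry.Resolution.WeightedResolutionDatum
import Mathlib.Algebra.MonoidAlgebra.NoZeroDivisors
import Mathlib.Algebra.Polynomial.Laurent
import HarnessLib

/-!
# The vertex point and the generic point of the vertex line of the full cobordant blow-up

Topic: `Summits/ResolutionOfSingularities/ResolutionOfSingularities/Theorems`. Stub
`stub_vertexPrimes` of the line `no-phi-rays-static-drop` of the crux
`Theses.WeightedInvariant.WeightedConstruction` (statement `stmt-ResolutionOfSingularities-0571`)
of the summit `Summit.ResolutionOfSingularities.ResolutionOfSingularities`. Pure commutative
algebra. Notation: `A` a commutative ring, `I : ℕ → Ideal A` a sequence of ideals,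
`E = A[t⁻¹, Iₙ tⁿ : n ≥ 1] = extReesAlgebra I ⊆ A[t, t⁻¹]` the extended Rees algebra
(Włodarczyk, arXiv:2203.03090, §2.2 and Def. 2.3.5: `B = Spec E` is the full cobordant blow-up
of `Spec A`), `s = t⁻¹ = extReesAlgebra.tInv I`, and `P` a prime of `A` containing every `Iₙ`,
`n ≥ 1` (a point of the centre).

* `coeff_mem_of_pos` — every element of `E` has all its coefficients of POSITIVE degree in `P`
  (induction on `Algebra.adjoin`: true for `t⁻¹`, for `a tⁿ` with `a ∈ Iₙ ≤ P`, for constants,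
  and stable under `+` and `*` since `i = j + k > 0` forces `j > 0` or `k > 0`);
* `coeff_zero_mul_sub_mem` — hence the constant coefficient is multiplicative modulo `P` on `E`;
* `exists_vertexHom` — the ring homomorphism `φ : E →+* A ⧸ P`, `x ↦ x₀ mod P` (kills `t⁻¹` and
  the `a tⁿ`); `mem_ker_genericHom_iff` — the kernel of `θ : E ⊆ A[t, t⁻¹] → (A ⧸ P)[t, t⁻¹]`
  (reduce all coefficients) is `E ∩ P[t, t⁻¹]`;
* `stub_vertexPrimes` — the stub (registered signature): `ξ = ker θ` (the generic point of the
  vertex line `V(P E + (Iₙ tⁿ))` over `P`, OFF `V(t⁻¹)`) specialises to `𝔟 = ker φ` (the vertex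
  point over `P`, ON `V(t⁻¹)`, containing the vertex ideal), and both contract to `P`. Both
  kernels are prime because their targets are domains (`A ⧸ P` and `(A ⧸ P)[t, t⁻¹]`).

## Sources

* J. Włodarczyk, *Functorial resolution by torus actions*, arXiv:2203.03090, §2.2, Def. 2.3.5.
  [Wlodarczyk2022]
-/

noncomputable section

open CategoryTheory AlgebraicGeometry TopologicalSpace
open Literature.AlgebraicGeometry.Resolution
open LaurentPolynomial
open scoped LaurentPolynomial

set_option linter.dupNamespace false -- mandated namespace of this single-conjunct summit

namespace Summit.ResolutionOfSingularities.ResolutionOfSingularities.Theorems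

namespace VertexPrimes

variable {A : Type} [CommRing A] (I : ℕ → Ideal A) (P : Ideal A)

/-- The coefficients of the Laurent monomial `a tⁿ`. [folklore] -/
theorem coeff_C_mul_T (a : A) (n i : ℤ) : (C a * T n).coeff i = if n = i then a else 0 := by
  rw [← single_eq_C_mul_T, AddMonoidAlgebra.coeff_single, Finsupp.single_apply]

/-- If every `Iₙ`, `n ≥ 1`, lies in the ideal `P`, then every element of the extended Rees algebra
`A[t⁻¹, Iₙ tⁿ]` has all its coefficients of positive degree in `P`: a monomial of positive degree
in the generators `t⁻¹`, `a tⁿ` contains at least one factor `a tⁿ`, `a ∈ Iₙ ≤ P`. [folklore] -/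
theorem coeff_mem_of_pos (hI : ∀ n : ℕ, 0 < n → I n ≤ P) {x : A[T;T⁻¹]}
    (hx : x ∈ extReesAlgebra I) : ∀ {i : ℤ}, 0 < i → x.coeff i ∈ P := by
  unfold extReesAlgebra at hx
  induction hx using Algebra.adjoin_induction with
  | mem x hx =>
    intro i hi
    rcases hx with rfl | ⟨n, hn, a, ha, rfl⟩
    · rw [T_apply, if_neg (by omega)]
      exact P.zero_mem
    · rw [coeff_C_mul_T]
      split_ifs
      · exact hI n hn ha
      · exact P.zero_mem
  | algebraMap r =>
    intro i hi
    rw [← C_eq_algebraMap, C_apply, if_neg hi.ne']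
    exact P.zero_mem
  | add x y _ _ hx hy =>
    intro i hi
    rw [AddMonoidAlgebra.coeff_add, Finsupp.add_apply]
    exact add_mem (hx hi) (hy hi)
  | mul x y _ _ hx hy =>
    intro i hi
    classical
    rw [AddMonoidAlgebra.coeff_mul]
    refine Finset.sum_induction _ (· ∈ P) (fun _ _ => add_mem) P.zero_mem fun j _ => ?_
    refine Finset.sum_induction _ (· ∈ P) (fun _ _ => add_mem) P.zero_mem fun k _ => ?_
    dsimp only
    split_ifs with hjk
    · by_cases hj : 0 < j
      · exact P.mul_mem_right _ (hx hj)
      · exact P.mul_mem_left _ (hy (by omega))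
    · exact P.zero_mem

/-- On the extended Rees algebra the constant coefficient is multiplicative modulo `P`:
`(x y)₀ = x₀ y₀ + Σ_{j ≠ 0} x_j y_{-j}` and one of `j`, `-j` is positive. [folklore] -/
theorem coeff_zero_mul_sub_mem (hI : ∀ n : ℕ, 0 < n → I n ≤ P) {x y : A[T;T⁻¹]}
    (hx : x ∈ extReesAlgebra I) (hy : y ∈ extReesAlgebra I) :
    (x * y).coeff 0 - x.coeff 0 * y.coeff 0 ∈ P := by
  classical
  have e : (x * y).coeff 0 = ∑ j ∈ insert 0 x.coeff.support, x.coeff j * y.coeff (-j + 0) := by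
    rw [AddMonoidAlgebra.coeff_mul_apply_left]
    exact Finsupp.sum_of_support_subset _ (Finset.subset_insert _ _) _ fun j _ => zero_mul _
  rw [e, ← Finset.add_sum_erase _ _ (Finset.mem_insert_self 0 _), neg_zero, add_zero,
    add_sub_cancel_left]
  refine Finset.sum_induction _ (· ∈ P) (fun _ _ => add_mem) P.zero_mem fun j hj => ?_
  rcases lt_or_gt_of_ne (Finset.mem_erase.mp hj).1 with h | h
  · exact P.mul_mem_left _ (coeff_mem_of_pos I P hI hy (by omega))
  · exact P.mul_mem_right _ (coeff_mem_of_pos I P hI hx h)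

/-- The **vertex point homomorphism** `A[t⁻¹, Iₙ tⁿ] → A ⧸ P`, `x ↦ x₀ mod P`, exists (as a
ring homomorphism): it kills `t⁻¹` and the `a tⁿ`, `n ≥ 1`, and reduces constants modulo `P`; its
kernel is the vertex point of the full cobordant blow-up over the point `P` of the centre.
[folklore] -/
theorem exists_vertexHom (hI : ∀ n : ℕ, 0 < n → I n ≤ P) :
    ∃ φ : extReesAlgebra I →+* A ⧸ P,
      ∀ x : extReesAlgebra I, φ x = Ideal.Quotient.mk P ((x : A[T;T⁻¹]).coeff 0) :=
  ⟨{ toFun := fun x => Ideal.Quotient.mk P ((x : A[T;T⁻¹]).coeff 0)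
     map_one' := by simp
     map_mul' := fun x y => by
       rw [← map_mul, Ideal.Quotient.eq, Subalgebra.coe_mul]
       exact coeff_zero_mul_sub_mem I P hI x.2 y.2
     map_zero' := by simp
     map_add' := fun x y => by simp }, fun _ => rfl⟩

/-- The **generic point homomorphism** `A[t⁻¹, Iₙ tⁿ] ⊆ A[t, t⁻¹] → (A ⧸ P)[t, t⁻¹]` (reduce the
coefficients modulo `P`) has kernel `A[t⁻¹, Iₙ tⁿ] ∩ P[t, t⁻¹]` — the elements all of whose
coefficients lie in `P` —, the generic point of the vertex line over `P`. [folklore] -/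
theorem mem_ker_genericHom_iff (x : extReesAlgebra I) :
    x ∈ RingHom.ker ((AddMonoidAlgebra.mapRingHom ℤ (Ideal.Quotient.mk P)).comp
        (extReesAlgebra I).val.toRingHom) ↔ ∀ i : ℤ, (x : A[T;T⁻¹]).coeff i ∈ P := by
  simp only [RingHom.mem_ker, RingHom.coe_comp, Function.comp_apply,
    LaurentPolynomial.ext_iff, AddMonoidAlgebra.coeff_mapRingHom, AddMonoidAlgebra.coeff_zero,
    Finsupp.coe_zero, Pi.zero_apply, Ideal.Quotient.eq_zero_iff_mem]
  rfl

end VertexPrimes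

open VertexPrimes in
/-- STUB `stub_vertexPrimes` of the line `no-phi-rays-static-drop`: for a sequence of ideals `I`
of `A` and a prime `P` containing every `Iₙ`, `n ≥ 1` (a point of the support), the extended Rees
algebra `A[t⁻¹, Iₙ tⁿ]` has two primes over `P`: the generic point `ξ = A[t⁻¹, Iₙ tⁿ] ∩ P[t, t⁻¹]`
of the vertex line over `P` (off `V(t⁻¹)`) and its specialisation, the vertex point
`𝔟 = ξ + (t⁻¹) + (Iₙ tⁿ : n ≥ 1)` on `V(t⁻¹)` (`A[t⁻¹, Iₙ tⁿ]/𝔟 ≅ A/P`). Here `ξ` and `𝔟` are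
the kernels of the reduction `A[t⁻¹, Iₙ tⁿ] → (A ⧸ P)[t, t⁻¹]` and of `x ↦ x₀ mod P`, prime as
kernels of ring maps to domains. [folklore] -/
theorem stub_vertexPrimes :
    ∀ {A : Type} [CommRing A] (I : ℕ → Ideal A) (P : Ideal A) [P.IsPrime],
      (∀ n : ℕ, 0 < n → I n ≤ P) →
      ∃ ξ 𝔟 : affineCobordantBlowup I, ξ ⤳ 𝔟 ∧
        extReesAlgebra.tInv I ∉ ξ.asIdeal ∧ extReesAlgebra.tInv I ∈ 𝔟.asIdeal ∧
        extReesAlgebra.vertexIdeal I ≤ 𝔟.asIdeal ∧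
        ξ.asIdeal.comap (algebraMap A (extReesAlgebra I)) = P ∧
        𝔟.asIdeal.comap (algebraMap A (extReesAlgebra I)) = P := by
  intro A _ I P _ hI
  obtain ⟨φ, hφ⟩ := exists_vertexHom I P hI
  let ξ : PrimeSpectrum (extReesAlgebra I) :=
    ⟨RingHom.ker ((AddMonoidAlgebra.mapRingHom ℤ (Ideal.Quotient.mk P)).comp
      (extReesAlgebra I).val.toRingHom), RingHom.ker_isPrime _⟩
  let 𝔟 : PrimeSpectrum (extReesAlgebra I) := ⟨RingHom.ker φ, RingHom.ker_isPrime _⟩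
  refine ⟨ξ, 𝔟, ?_, ?_, ?_, ?_, ?_, ?_⟩
  · -- `ξ ≤ 𝔟`: all coefficients in `P`, in particular the constant one
    refine (PrimeSpectrum.le_iff_specializes ξ 𝔟).mp fun x hx => ?_
    change x ∈ RingHom.ker φ
    rw [RingHom.mem_ker, hφ, Ideal.Quotient.eq_zero_iff_mem]
    exact (mem_ker_genericHom_iff I P x).mp hx 0
  · -- `t⁻¹ ∉ ξ`: its coefficient of degree `-1` is `1 ∉ P`
    intro h
    have h1 : (1 : A) ∈ P := by
      simpa using (mem_ker_genericHom_iff I P _).mp h (-1)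
    exact Ideal.IsPrime.ne_top ‹_› ((Ideal.eq_top_iff_one P).mpr h1)
  · -- `t⁻¹ ∈ 𝔟`: `(t⁻¹)₀ = 0`
    change extReesAlgebra.tInv I ∈ RingHom.ker φ
    simp [hφ]
  · -- the vertex ideal lies in `𝔟`: `(a tⁿ)₀ = 0` for `n ≥ 1`
    refine Ideal.span_le.mpr ?_
    rintro x ⟨n, hn, a, -, hx⟩
    change x ∈ RingHom.ker φ
    rw [RingHom.mem_ker, hφ, hx, coeff_C_mul_T, if_neg (by exact_mod_cast hn.ne'), map_zero]
  · -- `ξ ∩ A = P`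
    ext a
    rw [Ideal.mem_comap]
    change algebraMap A (extReesAlgebra I) a ∈ RingHom.ker _ ↔ _
    rw [mem_ker_genericHom_iff, Subalgebra.coe_algebraMap, ← C_eq_algebraMap]
    refine ⟨fun h => by simpa using h 0, fun h i => ?_⟩
    rw [C_apply]
    split_ifs
    · exact h
    · exact P.zero_mem
  · -- `𝔟 ∩ A = P`
    ext a
    rw [Ideal.mem_comap]
    change algebraMap A (extReesAlgebra I) a ∈ RingHom.ker φ ↔ _
    rw [RingHom.mem_ker, hφ, Subalgebra.coe_algebraMap, ← C_eq_algebraMap, C_apply,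
      if_pos rfl, Ideal.Quotient.eq_zero_iff_mem]

end Summit.ResolutionOfSingularities.ResolutionOfSingularities.Theorems

end
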